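import Literature.Barriers.CriticalPhenomena.LongRangeTrivialityOnZ3InfraredBoundHolds

/-!
# Proposition 3.8's first display in kernel form, for every `α`: DISCHARGE of `panis_prop38_kernelForm`
# (Panis 2023, Proposition 3.8) by the torus route with the exact infrared kernel

Sibling of `Literature/Barriers/CriticalPhenomena/LongRangeTrivialityOnZ3InfraredBound.lean` (barrier
catalogue D-0021, sub-problem `Ising3DConformalLimit`), which vendors the named fact
`Literature.Barriers.CriticalPhenomena.panis_prop38_kernelForm` — the first display of Proposition 3.8 of
R. Panis, *Triviality of the scaling limits of critical Ising and `φ⁴` models with effective dimension at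
least four*, arXiv:2309.05797 = Ann. Probab. 54 (2026), for `J_{x,y} = C₀|x-y|₁^{-d-α}`, with the Gaussian
weight `e^{-‖p‖₂²}` replaced by the larger product kernel `W(p) = ∏ᵢ(1 ∨ pᵢ²)⁻¹`:
for `d ≥ 3`, `C₀, α > 0` there is `C` with
`S_β(x) ≤ C/(β|x|^d) ∫_{(-π|x|,π|x|]^d} W(p)/(1 - Ĵ(p/|x|)) dp` for all `0 < β ≤ β_c`, `x ≠ 0`
(`S_β = ⟨σ₀σ_x⟩_β` the free-boundary state, `|x| = ‖x‖_∞`, `Ĵ = couplingFourier`). This file proves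
`theorem panis_prop38_kernelForm_holds : panis_prop38_kernelForm`, for EVERY `α > 0` — including
`α = 2`, where the exact kernel carries the logarithmic improvement `|x|^{2-d}(log|x|)^{-1}` of the
printed display and no power-law majorant of `1/(1-Ĵ)` would do.

## The proof (Panis's proof of Proposition 3.8 run on the even tori)

The printed proof combines MMS2, the Gaussian-weighted susceptibility `χ̃_L` in Fourier variables and
Proposition 3.7 (the infrared bound in infinite volume, resting on the uniqueness of the state, the
Simon–Lieb inequality and the finiteness of the susceptibility below `β_c` [ABF]). As in the sequel
`LongRangeTrivialityOnZ3InfraredBoundHolds.lean` (which discharged `panis_infraredBound_algebraic` for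
`α ≠ 2` through the power majorant `‖θ‖^{-(α∧2)}` of the kernel and a purely discrete Riemann-sum bound),
Proposition 3.7 is replaced by the torus infrared bound (Proposition 3.4, the tree's theorem
`torus_twoPointFourier_le` of `…TorusRP.lean`: reflection positivity of the periodised power-law coupling,
Gaussian domination, with the Fröhlich–Simon–Spencer constant `1/(β|J|(1-Ĵ(θ_k)))`), the vanishing of the
torus zero mode below `β_c` (`torus_zeroMode_le_eventually`, `…TorusZeroMode.lean`, from `m*(β) = 0`) and
Griffiths' comparison free ≤ torus (`sum_sum_pairCorrelation_le_of_torus`). What is new here is that the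
kernel `1/(1 - Ĵ(θ))` is kept EXACT, which requires a genuine Riemann-sum-to-integral step:

1. `riemannSum_le_setIntegral_add` — a one-sided Riemann-sum bound on the punctured grid of the even
   torus, for a general `g ≥ 0` integrable on `[-π,π]^d`, continuous away from the origin, with
   `g(p) ≤ A‖p‖^{-2}` (`d ≥ 3`): `δ^d∑_{j≠j₀} g(c_j) ≤ ∫_{[-π,π]^d} g + ε` for large even `N` (`δ = 2π/N`,
   cells `c_j + [0,δ)^d` of `[-π,π)^d` from `LatticeGreenRiemannSum.lean`; far cells by uniform continuity,
   near cells by the lattice sum `∑_{0<‖m‖≤R}‖m‖^{-2} = O(R^{d-2})`, near-cell integrals dropped);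
2. periodicity: `Ĵ(p + 2πq) = Ĵ(p)`, the box character sum is `2π`-periodic, and the centred momentum
   `θ_k` agrees with the cell corner `c_{k+j₀}` modulo `2πℤ^d`;
3. `torus_sum_sum_box_le_kernel` — Parseval on `𝕋_N` (`sum_sum_box_kernel_eq_fourier`), the torus infrared
   bound off the zero mode and the Fejér envelope `‖∑_{Λ_L}e^{iθ·x}‖² ≤ (9π²)^dL^{2d}W(Lθ)`:
   `∑_{x,y∈Λ_L}G_N(x̄-ȳ) ≤ N^{-d}Ŝ_N(0)(2L+1)^{2d} + (9π²)^dL^{2d}/(β|J|)·(2π)^{-d}δ^d∑_{j≠j₀}W(Lc_j)/(1-Ĵ(c_j))`;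
4. `sum_sum_pairCorrelation_le_kernel` — for `0 < β < β_c`, `L ≥ 1`:
   `∑_{x,y∈Λ_L}S_β(x-y) ≤ (9π²)^d/(2π)^d · L^d/(β|J|) ∫_{(-πL,πL]^d} W(u)/(1-Ĵ(u/L)) du`
   (steps 1–3, the zero mode, Griffiths' comparison, `u = Lθ`); this is the shape of
   `sum_sum_pairCorrelation_le` of `…InfraredBoundFourier.lean` (there conditional on Proposition 3.7 and
   the ABF summability), now unconditional and with the constant halved;
5. `panis_prop38_kernelForm_holds` — the `x`-space step of the printed proof verbatim
   (`panis_prop38_kernelForm_of_prop37`): MMS2 (`panis_mms_two_point_monotone_holds`) averaged over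
   `Λ_{⌊n/d⌋}`, `|Λ_{⌊n/2⌋}|χ_{⌊n/2⌋} ≤ ∑_{Λ_n²}S`, step 4 with `L = n = |x|_∞`, and left-continuity at `β_c`.

Not here: the printed first display with the Gaussian weight (`panis_prop38_firstDisplay`, stronger), and
Proposition 3.7 / the ABF summability (`panis_prop37_infraredBound`, `abf_pairCorrelation_summable`), which
remain named facts of `…InfraredBoundFourier.lean` and are no longer on the trust path of anything proved
in this chain. On constants: with the Hamiltonian `-∑_{{x,y}}J_{x,y}σ_xσ_y` of §1.2.1 Gaussian domination
yields `Ŝ ≤ 1/(β|J|(1-Ĵ))`; the additional factor `1/2` printed in Propositions 3.4 and 3.7 already fails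
for the nearest-neighbour chain (`d = 1`, `β = 1/2`, `p = π`: `Ŝ(π) = e^{-1} > 1/4`), as recorded for the
nearest-neighbour tree in `Literature/Probability/LatticeModels/LroInfraredBound.lean`; the existential
constant of `panis_prop38_kernelForm` is insensitive to this.

## References

* R. Panis, arXiv:2309.05797 (2023) = Ann. Probab. 54 (2026), §3.1 (`J^{(L)}`), §3.3: Proposition 3.4,
  Remark 3.5, Proposition 3.7, Proposition 3.8 and its proof (MMS2 averaging, `χ̃_L`, "classical Fourier
  identities", "the change of variable `u = pL`"), Corollary 3.3 [Panis2023Triviality] (held as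
  `paper:arxiv-2309.05797`, pp. 13–14 read).
* M. Aizenman, H. Duminil-Copin, V. Sidoravicius, CMP 334 (2015), §3.3, eqs. (3.15) (Riemann
  approximation), (3.17) (zero mode), (3.19) (free ≤ torus) [AizenmanDuminilCopinSidoraviciusCMP2015].
* J. Fröhlich, B. Simon, T. Spencer, CMP 50 (1976), §3; Friedli–Velenik 2017, Thm. 10.24 (the constant).
* Tree: `LatticeGreenRiemannSum.lean` (cells, `sum_box_inv_norm_sq_le`, `setIntegral_brillouin_eq_sum_gridCell`),
  `…TorusRP.lean`, `…TorusZeroMode.lean`, `…InfraredBoundHolds.lean`, `…InfraredBoundFourier.lean`; Mathlib: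
  `Measure.setIntegral_comp_smul_of_pos`, `Measure.univ_pi_Ioc_ae_eq_Icc`,
  `IsCompact.uniformContinuousOn_of_continuous`, `norm_setIntegral_le_of_norm_le_const`.
-/

noncomputable section

namespace Literature.Barriers.CriticalPhenomena

open Literature.Probability.LatticeModels Literature.Probability.Percolation Filter Topology Finset
open _root_.MeasureTheory
open scoped symmDiff

namespace LongRangeIsing

/-! ### A Riemann-sum upper bound on the punctured grid of the even torus (`d ≥ 3`) -/

section RiemannUpper

variable {d : ℕ}

/-- **Grid sum over the near cells** for a function with `g(p) ≤ A/‖p‖²` on the punctured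
Brillouin zone: for even `N` and `d ≥ 3`, `∑_{j near, j ≠ j₀} δ^d g(c_j) ≤ 2A·d·3^{d-1} η^{d-2}`,
uniformly in `N` (`‖c_j‖ = δ‖m_j‖` and the lattice sum `∑_{0<‖m‖≤R}‖m‖^{-2} ≤ 2d3^{d-1}R^{d-2}`;
the argument of `sum_nearCells_abs_greenIntegrand_le` for a general majorised `g`). [folklore] -/
theorem sum_nearCells_mul_le (hd : 3 ≤ d) {N : ℕ} [NeZero N] (hN : Even N) {g : (Fin d → ℝ) → ℝ}
    {A : ℝ} (hA : 0 ≤ A) (hgb : ∀ p ∈ brillouin d, p ≠ 0 → g p ≤ A * (‖p‖ ^ 2)⁻¹) {η : ℝ} (hη : 0 < η) :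
    ∑ j ∈ (nearCells d N η).erase (centerIndex d N), gridStep N ^ d * g (cellCorner j) ≤
      2 * A * d * 3 ^ (d - 1) * η ^ (d - 2) := by
  have hδ := gridStep_pos N
  set R : ℕ := ⌊η / gridStep N⌋₊ with hR
  set S := (nearCells d N η).erase (centerIndex d N) with hS
  -- termwise bound
  have hterm : ∀ j ∈ S, gridStep N ^ d * g (cellCorner j) ≤
      A * gridStep N ^ (d - 2) * (‖cellOffset j‖ ^ 2)⁻¹ := by
    intro j hj
    have hj0 : j ≠ centerIndex d N := (Finset.mem_erase.1 hj).1
    have hm0 : cellOffset j ≠ 0 := fun h => hj0 ((cellOffset_eq_zero_iff j).1 h)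
    have hmpos : 0 < ‖cellOffset j‖ := norm_pos_iff.2 hm0
    have hc0 : cellCorner j ≠ 0 := by
      intro h
      have := norm_cellCorner hN j
      rw [h, norm_zero] at this
      nlinarith
    have hb := hgb _ (cellCorner_mem_brillouin j) hc0
    rw [norm_cellCorner hN j] at hb
    obtain ⟨e, rfl⟩ : ∃ e, d = e + 2 := ⟨d - 2, by omega⟩
    rw [show e + 2 - 2 = e by omega]
    calc gridStep N ^ (e + 2) * g (cellCorner j)
        ≤ gridStep N ^ (e + 2) * (A * ((gridStep N * ‖cellOffset j‖) ^ 2)⁻¹) :=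
          mul_le_mul_of_nonneg_left hb (by positivity)
      _ = A * gridStep N ^ e * (‖cellOffset j‖ ^ 2)⁻¹ := by
          field_simp
          ring
  -- the offsets of near cells lie in `Λ_R ∖ {0}`
  have himage : S.image cellOffset ⊆ (box d R).erase 0 := by
    intro m hm
    obtain ⟨j, hj, rfl⟩ := Finset.mem_image.1 hm
    have hj0 : j ≠ centerIndex d N := (Finset.mem_erase.1 hj).1
    have hjn : ∀ i, |cellCorner j i| ≤ η := (Finset.mem_filter.1 (Finset.mem_erase.1 hj).2).2
    refine Finset.mem_erase.2 ⟨fun h => hj0 ((cellOffset_eq_zero_iff j).1 h), ?_⟩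
    rw [mem_box_iff_supNorm_le, Site.supNorm_le_iff]
    intro i
    have h1 : |(cellOffset j i : ℝ)| ≤ η / gridStep N := by
      rw [le_div_iff₀ hδ, mul_comm, ← abs_of_pos hδ, ← abs_mul, ← cellCorner_eq_gridStep_mul hN]
      exact hjn i
    have h2 : (((cellOffset j i).natAbs : ℕ) : ℝ) ≤ η / gridStep N := by
      rw [Nat.cast_natAbs, Int.cast_abs]; exact h1
    exact (Nat.le_floor_iff (div_nonneg hη.le hδ.le)).2 h2
  -- compare with the lattice sum
  have hsum : ∑ j ∈ S, (‖cellOffset j‖ ^ 2)⁻¹ ≤ ∑ m ∈ (box d R).erase 0, (‖m‖ ^ 2)⁻¹ := by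
    rw [← Finset.sum_image (f := fun m : Site d => (‖m‖ ^ 2)⁻¹)
      (fun j _ j' _ h => cellOffset_injective d N h)]
    exact Finset.sum_le_sum_of_subset_of_nonneg himage fun _ _ _ => by positivity
  have hlat := sum_box_inv_norm_sq_le d hd R
  have hRη : gridStep N * R ≤ η := by
    rw [mul_comm, ← le_div_iff₀ hδ]
    exact Nat.floor_le (div_nonneg hη.le hδ.le)
  obtain ⟨e, rfl⟩ : ∃ e, d = e + 3 := ⟨d - 3, by omega⟩
  rw [show e + 3 - 1 = e + 2 by omega, show e + 3 - 2 = e + 1 by omega] at hlat ⊢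
  rw [show e + 3 - 2 = e + 1 by omega] at hterm
  calc ∑ j ∈ S, gridStep N ^ (e + 3) * g (cellCorner j)
      ≤ ∑ j ∈ S, A * gridStep N ^ (e + 1) * (‖cellOffset j‖ ^ 2)⁻¹ := Finset.sum_le_sum hterm
    _ = A * gridStep N ^ (e + 1) * ∑ j ∈ S, (‖cellOffset j‖ ^ 2)⁻¹ := by rw [Finset.mul_sum]
    _ ≤ A * gridStep N ^ (e + 1) * (2 * ((e + 3 : ℕ) : ℝ) * 3 ^ (e + 2) * (R : ℝ) ^ (e + 1)) := by
        gcongr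
        exact hsum.trans hlat
    _ = 2 * A * ((e + 3 : ℕ) : ℝ) * 3 ^ (e + 2) * (gridStep N * R) ^ (e + 1) := by ring
    _ ≤ 2 * A * ((e + 3 : ℕ) : ℝ) * 3 ^ (e + 2) * η ^ (e + 1) := by gcongr

/-- **A far cell**: if `g` varies by at most `ε'` on the cell `c_j + [0,δ)^d`, then
`δ^d g(c_j) ≤ ∫_{cell_j} g + δ^d ε'`. [folklore] -/
theorem mul_le_setIntegral_gridCell_add {N : ℕ} [NeZero N] {g : (Fin d → ℝ) → ℝ} (j : TorusSite d N)
    {ε' : ℝ} (hint : IntegrableOn g (gridCell j))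
    (hcell : ∀ p ∈ gridCell j, |g p - g (cellCorner j)| ≤ ε') :
    gridStep N ^ d * g (cellCorner j) ≤ (∫ p in gridCell j, g p) + gridStep N ^ d * ε' := by
  have hvol : volume.real (gridCell j) = gridStep N ^ d := by
    rw [measureReal_def, volume_gridCell_toReal]
  have hlt := volume_gridCell_lt_top j
  have hconst : ∫ _ in gridCell j, g (cellCorner j) = gridStep N ^ d * g (cellCorner j) := by
    rw [setIntegral_const, smul_eq_mul, hvol]
  have hci : IntegrableOn (fun _ => g (cellCorner j)) (gridCell j) := integrableOn_const hlt.ne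
  have hdiff : |gridStep N ^ d * g (cellCorner j) - ∫ p in gridCell j, g p| ≤ gridStep N ^ d * ε' := by
    rw [← hconst, ← integral_sub hci hint]
    have h := norm_setIntegral_le_of_norm_le_const hlt (f := fun p => g (cellCorner j) - g p) (C := ε')
      fun p hp => by rw [Real.norm_eq_abs, abs_sub_comm]; exact hcell p hp
    calc |∫ p in gridCell j, g (cellCorner j) - g p| ≤ ε' * gridStep N ^ d := by
          simpa [Real.norm_eq_abs, hvol] using h
      _ = gridStep N ^ d * ε' := mul_comm _ _
  have := (abs_sub_le_iff.1 hdiff).1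
  linarith

variable (d) in
/-- **Riemann-sum upper bound on the punctured grid** (the "standard approximation argument" of
ADS15 §3.3 for (3.15), one-sided and for a general integrand): let `d ≥ 3` and let `g` be
nonnegative and integrable on `[-π,π]^d`, continuous away from every neighbourhood of the origin,
with `g(p) ≤ A‖p‖^{-2}` for `p ≠ 0`. Then for every `ε > 0`, for all large even `N`, with
`δ = 2π/N` and the cells `c_j + [0,δ)^d` of `[-π,π)^d`,
`δ^d ∑_{j ≠ j₀} g(c_j) ≤ ∫_{[-π,π]^d} g + ε` (far cells by uniform continuity, near cells by the
lattice sum `O(η^{d-2})`, near-cell integrals dropped since `g ≥ 0`). [cite: AizenmanDuminilCopinSidoraviciusCMP2015, §3.3, arXiv v3 eq. (3.15) ("standard approximation arguments")] -/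
theorem riemannSum_le_setIntegral_add (hd : 3 ≤ d) {g : (Fin d → ℝ) → ℝ} {A : ℝ} (hA : 0 ≤ A)
    (hg0 : ∀ p ∈ brillouin d, 0 ≤ g p)
    (hgb : ∀ p ∈ brillouin d, p ≠ 0 → g p ≤ A * (‖p‖ ^ 2)⁻¹)
    (hgc : ∀ η : ℝ, 0 < η → ContinuousOn g (farRegion d η))
    (hgi : IntegrableOn g (brillouin d)) {ε : ℝ} (hε : 0 < ε) :
    ∃ N₀ : ℕ, ∀ (N : ℕ) [NeZero N], Even N → N₀ ≤ N →
      gridStep N ^ d * ∑ j ∈ (univ : Finset (TorusSite d N)).erase (centerIndex d N), g (cellCorner j) ≤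
        (∫ p in brillouin d, g p) + ε := by
  have hd0 : (0 : ℝ) < d := by exact_mod_cast (by omega : 0 < d)
  set Cπ : ℝ := (2 * Real.pi) ^ d with hCπ
  have hCπ_pos : 0 < Cπ := by positivity
  set C₁ : ℝ := 2 * A * d * 3 ^ (d - 1) + 1 with hC₁
  have hC₁_pos : 0 < C₁ := by positivity
  -- the size `η` of the neighbourhood of the singularity
  set η : ℝ := min 1 (ε / (2 * C₁)) with hη
  have hη_pos : 0 < η := lt_min one_pos (by positivity)
  have hη1 : η ≤ 1 := min_le_left _ _
  have hηC : C₁ * η ≤ ε / 2 := by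
    have h : η ≤ ε / (2 * C₁) := min_le_right _ _
    rw [le_div_iff₀ (by positivity)] at h
    linarith
  -- uniform continuity of `g` away from the singularity
  have huc := (isCompact_farRegion d (η / 2)).uniformContinuousOn_of_continuous (hgc (η / 2) (by positivity))
  obtain ⟨η', hη', hUC⟩ := Metric.uniformContinuousOn_iff_le.1 huc (ε / (2 * Cπ)) (by positivity)
  -- the threshold `N₀`: grid step below `min (η/2) η'`
  set m : ℝ := min (η / 2) η' with hm
  have hm_pos : 0 < m := lt_min (by positivity) hη'
  obtain ⟨N₀, hN₀⟩ := exists_nat_gt (2 * Real.pi / m)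
  refine ⟨N₀, fun N _ hNe hN₀N => ?_⟩
  have hNr : 2 * Real.pi / m < N := lt_of_lt_of_le hN₀ (by exact_mod_cast hN₀N)
  have hNpos : (0 : ℝ) < N := lt_trans (by positivity) hNr
  have hδ : gridStep N ≤ m := by
    unfold gridStep
    rw [div_le_iff₀ hNpos]
    rw [div_lt_iff₀ hm_pos] at hNr
    linarith
  have hδη2 : gridStep N ≤ η / 2 := hδ.trans (min_le_left _ _)
  have hδη' : gridStep N ≤ η' := hδ.trans (min_le_right _ _)
  have hδpos := gridStep_pos N
  set j₀ := centerIndex d N with hj₀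
  set T : TorusSite d N → ℝ := fun j => gridStep N ^ d * g (cellCorner j) with hT
  set I : TorusSite d N → ℝ := fun j => ∫ p in gridCell j, g p with hI'
  set Nr := nearCells d N η with hNr'
  have hI0 : ∀ j, 0 ≤ I j := fun j =>
    setIntegral_nonneg (measurableSet_gridCell j) fun p hp => hg0 p (gridCell_subset_brillouin j hp)
  -- `∫_{[-π,π]^d} g = ∑_j ∫_{cell_j} g`
  have hIsum : ∫ p in brillouin d, g p = ∑ j, I j := setIntegral_brillouin_eq_sum_gridCell N hgi
  -- split the index set into near and far cells
  have hj₀N : j₀ ∈ Nr := by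
    refine Finset.mem_filter.2 ⟨mem_univ _, fun i => ?_⟩
    rw [hj₀, cellCorner_centerIndex d hNe]
    simp [hη_pos.le]
  have hsdiff : univ.erase j₀ \ Nr.erase j₀ = univ \ Nr := by
    ext j
    simp only [Finset.mem_sdiff, Finset.mem_erase, mem_univ, and_true, true_and, not_and]
    constructor
    · rintro ⟨hj, h⟩; exact h hj
    · intro h; exact ⟨fun hjj => h (hjj ▸ hj₀N), fun _ => h⟩
  have hsplitT : ∑ j ∈ univ.erase j₀, T j = ∑ j ∈ univ \ Nr, T j + ∑ j ∈ Nr.erase j₀, T j := by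
    rw [← Finset.sum_sdiff (Finset.erase_subset_erase j₀ (subset_univ Nr)), hsdiff]
  have hsplitI : ∑ j, I j = ∑ j ∈ univ \ Nr, I j + ∑ j ∈ Nr, I j := by
    rw [← Finset.sum_sdiff (subset_univ Nr)]
  -- (a) far cells
  have hfar : ∀ j ∈ univ \ Nr, T j ≤ I j + gridStep N ^ d * (ε / (2 * Cπ)) := by
    intro j hj
    have hjN : j ∉ Nr := (Finset.mem_sdiff.1 hj).2
    have hsub := gridCell_subset_farRegion hδη2 hjN
    refine mul_le_setIntegral_gridCell_add j (hgi.mono_set (gridCell_subset_brillouin j)) fun p hp => ?_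
    have h := hUC p (hsub hp) (cellCorner j) (hsub (cellCorner_mem_gridCell j)) ?_
    · rwa [Real.dist_eq] at h
    · refine (dist_pi_le_iff hδpos.le).2 (fun i => ?_) |>.trans hδη'
      have hpi := hp i (Set.mem_univ i)
      rw [Real.dist_eq, abs_le]
      constructor <;> linarith [hpi.1, hpi.2]
  have hcard : (#(univ \ Nr) : ℝ) * gridStep N ^ d ≤ Cπ := by
    have h1 : (#(univ \ Nr) : ℝ) ≤ (N : ℝ) ^ d := by
      have := Finset.card_le_univ (univ \ Nr)
      rw [card_torusSite] at this
      exact_mod_cast this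
    calc (#(univ \ Nr) : ℝ) * gridStep N ^ d ≤ (N : ℝ) ^ d * gridStep N ^ d := by gcongr
      _ = Cπ := by rw [← mul_pow, mul_comm, gridStep_mul]
  have ha : ∑ j ∈ univ \ Nr, T j ≤ ∑ j ∈ univ \ Nr, I j + ε / 2 := by
    calc ∑ j ∈ univ \ Nr, T j ≤ ∑ j ∈ univ \ Nr, (I j + gridStep N ^ d * (ε / (2 * Cπ))) :=
          Finset.sum_le_sum hfar
      _ = ∑ j ∈ univ \ Nr, I j + #(univ \ Nr) * gridStep N ^ d * (ε / (2 * Cπ)) := by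
          rw [Finset.sum_add_distrib, sum_const, nsmul_eq_mul, mul_assoc]
      _ ≤ ∑ j ∈ univ \ Nr, I j + Cπ * (ε / (2 * Cπ)) := by gcongr
      _ = ∑ j ∈ univ \ Nr, I j + ε / 2 := by field_simp
  -- (b) near cells, grid part
  have hb : ∑ j ∈ Nr.erase j₀, T j ≤ ε / 2 := by
    have h1 := sum_nearCells_mul_le hd hNe hA hgb hη_pos
    have h2 : η ^ (d - 2) ≤ η := pow_le_of_le_one hη_pos.le hη1 (by omega)
    calc ∑ j ∈ Nr.erase j₀, T j ≤ 2 * A * d * 3 ^ (d - 1) * η ^ (d - 2) := h1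
      _ ≤ 2 * A * d * 3 ^ (d - 1) * η := by gcongr
      _ ≤ C₁ * η := by
          refine mul_le_mul_of_nonneg_right ?_ hη_pos.le
          rw [hC₁]; linarith
      _ ≤ ε / 2 := hηC
  -- (c) near cells, integral part is nonnegative
  have hc : 0 ≤ ∑ j ∈ Nr, I j := Finset.sum_nonneg fun j _ => hI0 j
  -- combine
  show gridStep N ^ d * ∑ j ∈ univ.erase j₀, g (cellCorner j) ≤ (∫ p in brillouin d, g p) + ε
  rw [Finset.mul_sum, hIsum, hsplitI]
  change ∑ j ∈ univ.erase j₀, T j ≤ _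
  rw [hsplitT]
  linarith

end RiemannUpper

/-! ### Periodicity in the momentum and the centred grid -/

section Periodicity

variable {d : ℕ}

/-- `(p + 2πq)·x = p·x + 2π(q·x)` for `x, q ∈ ℤ^d`. [folklore] -/
theorem phase_add_two_pi_mul (p : Fin d → ℝ) (q : Fin d → ℤ) (x : Site d) :
    phase (fun i => p i + 2 * Real.pi * q i) x = phase p x + ((∑ i, q i * x i : ℤ) : ℝ) * (2 * Real.pi) := by
  simp only [phase]
  push_cast
  simp only [Finset.sum_mul, ← Finset.sum_add_distrib]
  exact Finset.sum_congr rfl fun i _ => by ring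

/-- **`Ĵ` is `2π`-periodic in every coordinate** (`x ∈ ℤ^d` in `∑_x cos(p·x)J_{0,x}`). [folklore] -/
theorem couplingFourier_add_two_pi_mul (J : Site d → Site d → ℝ) (p : Fin d → ℝ) (q : Fin d → ℤ) :
    couplingFourier J (fun i => p i + 2 * Real.pi * q i) = couplingFourier J p := by
  unfold couplingFourier
  congr 1
  refine tsum_congr fun x => ?_
  rw [phase_add_two_pi_mul, Real.cos_add_int_mul_two_pi]

/-- **The box character sum is `2π`-periodic in the momentum.** [folklore] -/
theorem sum_box_cexp_add_two_pi_mul (L : ℕ) (p : Fin d → ℝ) (q : Fin d → ℤ) :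
    ∑ x ∈ box d L, Complex.exp (Complex.I * (phase (fun i => p i + 2 * Real.pi * q i) x : ℂ)) =
      ∑ x ∈ box d L, Complex.exp (Complex.I * (phase p x : ℂ)) := by
  refine Finset.sum_congr rfl fun x _ => ?_
  rw [phase_add_two_pi_mul, Complex.ofReal_add, mul_add, Complex.exp_add]
  have h : Complex.exp (Complex.I * ((((∑ i, q i * x i : ℤ) : ℝ) * (2 * Real.pi) : ℝ) : ℂ)) = 1 := by
    have := Complex.exp_int_mul_two_pi_mul_I (∑ i, q i * x i)
    rw [← this]
    congr 1
    push_cast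
    ring
  rw [h, mul_one]

/-- Points of the Brillouin zone lie in the cube `‖p‖_∞ ≤ π`. [folklore] -/
theorem norm_le_pi_of_mem_brillouin {p : Fin d → ℝ} (hp : p ∈ brillouin d) : ‖p‖ ≤ Real.pi :=
  (pi_norm_le_iff_of_nonneg Real.pi_pos.le).2 fun i => by
    have h := hp i (Set.mem_univ i)
    rw [Real.norm_eq_abs, abs_le]
    exact ⟨h.1, h.2⟩

variable {N : ℕ}

/-- **The centred momentum `θ_k` and the corner `c_{k+j₀}` of the shifted cell agree modulo `2πℤ^d`**
(`N` even): both represent `2πk/N`. [folklore] -/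
theorem exists_centeredMomentum_eq_cellCorner_add [NeZero N] (hN : Even N) (k : TorusSite d N) :
    ∃ q : Fin d → ℤ, centeredMomentum N k =
      fun i => cellCorner (k + centerIndex d N) i + 2 * Real.pi * q i := by
  obtain ⟨q, hq⟩ := cellCorner_add_centerIndex hN k
  have hN0 : (N : ℝ) ≠ 0 := by exact_mod_cast NeZero.ne N
  refine ⟨fun i => (if 2 * (k i).val ≤ N then 0 else -1) - q i, funext fun i => ?_⟩
  rw [hq]
  simp only [centeredMomentum, centeredRep, latticeMomentum]
  split_ifs with h
  · push_cast
    ring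
  · push_cast
    field_simp
    ring

end Periodicity

/-! ### The torus double sum with the exact infrared kernel -/

section TorusKernel

variable {d N : ℕ} {C₀ α : ℝ}

/-- **The double sum of the torus two-point function over `Λ_L × Λ_L`, zero mode plus the exact
infrared kernel.** For `J_{x,y} = C₀|x-y|₁^{-d-α}` (`d ≥ 3`, `C₀, α > 0`, any `α`), a cube bound
`1 - Ĵ(q) ≥ c₁‖q‖²`, `N` even, `N ≥ 4`, `L ≥ 1`, `β > 0`, `G_N(z) = ⟨σ₀σ_z⟩_{𝕋_N,J^{(N)},β}`, `δ = 2π/N`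
and the cell corners `c_j` of `[-π,π)^d`:
`∑_{x,y∈Λ_L}G_N(x̄-ȳ) ≤ N^{-d}(∑_zG_N(z))(2L+1)^{2d} + (9π²)^dL^{2d}/(β|J|)·(2π)^{-d}δ^d∑_{j≠j₀}W(Lc_j)/(1-Ĵ(c_j))`
(Parseval on the torus, the torus infrared bound `Ŝ_N(k) ≤ 1/(β|J|(1-Ĵ(θ_k)))` off the zero mode,
periodicity `θ_k ≡ c_{k+j₀}`, and the Fejér envelope).
[cite: Panis2023Triviality, proof of Proposition 3.8 (χ̃_L ≤ C₃L^d∫e^{-L²‖p‖²}Ŝ(p)dp with Proposition 3.4), torus version] -/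
theorem torus_sum_sum_box_le_kernel (hd : 3 ≤ d) (hC₀ : 0 < C₀) (hα : 0 < α) {c₁ : ℝ} (hc₁ : 0 < c₁)
    (hcube : ∀ q : Fin d → ℝ, ‖q‖ ≤ Real.pi →
      c₁ * ‖q‖ ^ 2 ≤ 1 - couplingFourier (algebraicCoupling d C₀ α) q)
    [NeZero N] (hNe : Even N) (hN4 : 4 ≤ N) {L : ℕ} (hL : 1 ≤ L) {β : ℝ} (hβ : 0 < β) :
    ∑ x ∈ box d L, ∑ y ∈ box d L, torusExpect (torusCoupling (algebraicCoupling d C₀ α) N) β 0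
        (fun σ => spinAt 0 σ * spinAt (Torus.proj N x - Torus.proj N y) σ) ≤
      ((N : ℝ) ^ d)⁻¹ * (∑ z, torusExpect (torusCoupling (algebraicCoupling d C₀ α) N) β 0
          (fun σ => spinAt 0 σ * spinAt z σ)) * ((((2 * L + 1 : ℕ) : ℝ) ^ d) ^ 2) +
        (9 * Real.pi ^ 2) ^ d * (L : ℝ) ^ (2 * d) / (β * couplingNorm (algebraicCoupling d C₀ α)) *
          (((2 * Real.pi) ^ d)⁻¹ * (gridStep N ^ d *
            ∑ j ∈ (univ : Finset (TorusSite d N)).erase (centerIndex d N),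
              envelope d ((L : ℝ) • cellCorner j) /
                (1 - couplingFourier (algebraicCoupling d C₀ α) (cellCorner j)))) := by
  have hd1 : 1 ≤ d := by omega
  set J := algebraicCoupling d C₀ α with hJ
  have hpos := couplingNorm_algebraic_pos hd1 hC₀ hα
  set G : TorusSite d N → ℝ := fun z => torusExpect (torusCoupling J N) β 0 (fun σ => spinAt 0 σ * spinAt z σ) with hG
  set θ : TorusSite d N → Fin d → ℝ := centeredMomentum N with hθ
  set B : TorusSite d N → ℝ := fun k => ‖∑ x ∈ box d L, Complex.exp (Complex.I * (phase (θ k) x : ℂ))‖ ^ 2 with hB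
  set S : TorusSite d N → ℝ := fun k => ∑ z, G z * (torusChar k z).re with hS
  set j₀ := centerIndex d N with hj₀
  set F : (Fin d → ℝ) → ℝ := fun c => envelope d ((L : ℝ) • c) / (1 - couplingFourier J c) with hF
  -- Parseval
  have hpar : ∑ x ∈ box d L, ∑ y ∈ box d L, G (Torus.proj N x - Torus.proj N y) =
      ((N : ℝ) ^ d)⁻¹ * ∑ k, S k * B k := sum_sum_box_kernel_eq_fourier G L
  -- the zero mode
  have h0 : S 0 * B 0 = (∑ z, G z) * ((((2 * L + 1 : ℕ) : ℝ) ^ d) ^ 2) := by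
    simp only [hS, hB, hθ, torusChar_zero_left, Complex.one_re, mul_one, centeredMomentum_zero]
    rw [norm_sum_box_cexp_zero_sq]
  -- the nonzero momenta
  set U : ℝ := (9 * Real.pi ^ 2) ^ d * (L : ℝ) ^ (2 * d) / (β * couplingNorm J) with hU
  have hU0 : 0 ≤ U := by positivity
  have hk : ∀ k ∈ Finset.univ.erase (0 : TorusSite d N), S k * B k ≤ U * F (cellCorner (k + j₀)) := by
    intro k hk
    have hk0 : k ≠ 0 := Finset.ne_of_mem_erase hk
    obtain ⟨q, hq⟩ := exists_centeredMomentum_eq_cellCorner_add hNe k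
    set c := cellCorner (k + j₀) with hc
    have hcπ : ‖c‖ ≤ Real.pi := norm_le_pi_of_mem_brillouin (cellCorner_mem_brillouin _)
    -- the gap at `θ_k` is the gap at `c`, and is positive
    have hJeq : couplingFourier J (θ k) = couplingFourier J c := by
      rw [hθ]
      show couplingFourier J (centeredMomentum N k) = couplingFourier J c
      rw [hq, couplingFourier_add_two_pi_mul]
    have hθpos : 0 < ‖centeredMomentum N k‖ := norm_centeredMomentum_pos hk0
    have hgapθ : 0 < 1 - couplingFourier J (centeredMomentum N k) := by
      have h1 := hcube _ (norm_centeredMomentum_le k)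
      have h2 : 0 < c₁ * ‖centeredMomentum N k‖ ^ 2 := by positivity
      linarith
    have hgapc : 0 < 1 - couplingFourier J c := by rw [← hJeq]; exact hgapθ
    -- the torus infrared bound
    have hSk : S k ≤ 1 / (β * (couplingNorm J * (1 - couplingFourier J c))) := by
      have h := torus_twoPointFourier_le hd1 hC₀ hα hNe hN4 hβ hgapθ
      rw [show couplingFourier (algebraicCoupling d C₀ α) (centeredMomentum N k) = couplingFourier J c from hJeq] at h
      exact h
    -- the Fejér envelope at the corner
    have hBk : B k ≤ (9 * Real.pi ^ 2) ^ d * (L : ℝ) ^ (2 * d) * envelope d ((L : ℝ) • c) := by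
      have e : B k = ‖∑ x ∈ box d L, Complex.exp (Complex.I * (phase c x : ℂ))‖ ^ 2 := by
        simp only [hB, hθ]
        rw [hq, sum_box_cexp_add_two_pi_mul]
      rw [e]
      exact norm_sum_box_cexp_sq_le hL hcπ
    have hB0 : 0 ≤ B k := sq_nonneg _
    have hb0 : 0 ≤ 1 / (β * (couplingNorm J * (1 - couplingFourier J c))) := by positivity
    calc S k * B k ≤ 1 / (β * (couplingNorm J * (1 - couplingFourier J c))) * B k :=
          mul_le_mul_of_nonneg_right hSk hB0
      _ ≤ 1 / (β * (couplingNorm J * (1 - couplingFourier J c))) *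
            ((9 * Real.pi ^ 2) ^ d * (L : ℝ) ^ (2 * d) * envelope d ((L : ℝ) • c)) :=
          mul_le_mul_of_nonneg_left hBk hb0
      _ = U * F c := by
          simp only [hU, hF]
          field_simp
  -- reindexing `k ↦ k + j₀`
  have hreindex : ∑ k ∈ Finset.univ.erase (0 : TorusSite d N), F (cellCorner (k + j₀)) =
      ∑ j ∈ Finset.univ.erase j₀, F (cellCorner j) := by
    rw [Finset.sum_erase_eq_sub (mem_univ _), Finset.sum_erase_eq_sub (mem_univ _), zero_add]
    congr 1
    exact Equiv.sum_comp (Equiv.addRight j₀) fun j => F (cellCorner j)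
  -- `N^{-d} = (2π)^{-d} δ^d`
  have hNd : ((N : ℝ) ^ d)⁻¹ = ((2 * Real.pi) ^ d)⁻¹ * gridStep N ^ d := by
    rw [← gridStep_mul N, mul_pow, mul_inv, mul_comm (gridStep N ^ d)⁻¹, mul_assoc,
      inv_mul_cancel₀ (pow_ne_zero _ (gridStep_pos N).ne'), mul_one]
  -- assemble
  rw [hpar, ← Finset.add_sum_erase _ _ (Finset.mem_univ (0 : TorusSite d N)), mul_add, h0]
  refine add_le_add (le_of_eq (by ring)) ?_
  calc ((N : ℝ) ^ d)⁻¹ * ∑ k ∈ Finset.univ.erase (0 : TorusSite d N), S k * B k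
      ≤ ((N : ℝ) ^ d)⁻¹ * ∑ k ∈ Finset.univ.erase (0 : TorusSite d N), U * F (cellCorner (k + j₀)) :=
        mul_le_mul_of_nonneg_left (Finset.sum_le_sum hk) (by positivity)
    _ = U * (((N : ℝ) ^ d)⁻¹ * ∑ j ∈ Finset.univ.erase j₀, F (cellCorner j)) := by
        rw [← Finset.mul_sum, hreindex]; ring
    _ = U * (((2 * Real.pi) ^ d)⁻¹ * (gridStep N ^ d * ∑ j ∈ Finset.univ.erase j₀, F (cellCorner j))) := by
        rw [hNd, mul_assoc]

end TorusKernel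

/-! ### Passage to `ℤ^d`: the Fejér-weighted double sum of the free state with the exact kernel -/

section InfiniteVolumeKernel

variable {d : ℕ} {C₀ α : ℝ}

/-- `(-π,π]^d` and `[-π,π]^d` agree up to a Lebesgue-null set. [folklore] -/
theorem momentumBox_one_ae_eq_brillouin : (momentumBox d 1 : Set (Fin d → ℝ)) =ᵐ[volume] brillouin d := by
  rw [MeasureTheory.volume_pi, momentumBox, brillouin]
  have := Measure.univ_pi_Ioc_ae_eq_Icc (μ := fun _ : Fin d => (volume : Measure ℝ))
    (f := fun _ => -(Real.pi * 1)) (g := fun _ => Real.pi * 1)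
  rw [← Set.pi_univ_Icc] at this
  simpa only [mul_one] using this

/-- **Gaussian domination of the Fejér-weighted double sum below `β_c`, with the exact infrared
kernel and the Fröhlich–Simon–Spencer constant** (`J_{x,y} = C₀|x-y|₁^{-d-α}`, `d ≥ 3`, `C₀, α > 0`
— every `α`, including `α = 2` —, `0 < β < β_c`, `L ≥ 1`):
`∑_{x,y∈Λ_L} S_β(x-y) ≤ (9π²)^d/(2π)^d · L^d/(β|J|) ∫_{(-πL,πL]^d} W(u)/(1 - Ĵ(u/L)) du`.
Proof (torus route): on the even tori `𝕋_N`, `N → ∞`, the zero mode is `o(N^d)` because `m*(β) = 0`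
below `β_c` (`torus_zeroMode_le_eventually`), the infrared part of `torus_sum_sum_box_le_kernel` is a
Riemann sum of the nonnegative kernel `W(Lθ)/(1-Ĵ(θ)) ≤ c₁⁻¹‖θ‖^{-2}`, bounded in the limit by its
integral (`riemannSum_le_setIntegral_add`), the free state is dominated by the torus states
(`sum_sum_pairCorrelation_le_of_torus`), and `u = Lθ`. This is the display
`χ̃_L(β) ≤ C₃L^d∫e^{-L²‖p‖²}Ŝ_β(p)dp ≤ …` of the printed proof with the torus infrared bound
(Proposition 3.4) in place of Proposition 3.7, i.e. without the uniqueness of the state and without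
the finiteness of the susceptibility below `β_c`.
[cite: Panis2023Triviality, proof of Proposition 3.8 (χ̃_L ≤ C₃L^d∫e^{-L²‖p‖₂²}Ŝ(p)dp, "with the change of variable u = pL"), with Proposition 3.4] -/
theorem sum_sum_pairCorrelation_le_kernel (hd : 3 ≤ d) (hC₀ : 0 < C₀) (hα : 0 < α) {β : ℝ} (hβ : 0 < β)
    (hβc : β < LongRangeIsing.criticalBeta (algebraicCoupling d C₀ α)) {L : ℕ} (hL : 1 ≤ L) :
    ∑ x ∈ box d L, ∑ y ∈ box d L, pairCorrelation (algebraicCoupling d C₀ α) β 0 (x - y) ≤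
      (9 * Real.pi ^ 2) ^ d / (2 * Real.pi) ^ d * ((L : ℝ) ^ d / (β * couplingNorm (algebraicCoupling d C₀ α))) *
        ∫ u in momentumBox d L, envelope d u / (1 - couplingFourier (algebraicCoupling d C₀ α) (fun i => u i / L)) := by
  have hd1 : 1 ≤ d := by omega
  set J := algebraicCoupling d C₀ α with hJ
  have hJt : ∀ a x y, J (x + a) (y + a) = J x y := algebraicCoupling_add C₀ α
  have hJnn : ∀ x y, 0 ≤ J x y := algebraicCoupling_nonneg hC₀.le α
  have hJ0 : ∀ y, 0 ≤ J 0 y := fun y => hJnn 0 y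
  have hJs := algebraicCoupling_zero_summable hd1 hC₀.le hα
  have hpos := couplingNorm_algebraic_pos hd1 hC₀ hα
  obtain ⟨c₁, hc₁, hcube⟩ := sq_le_one_sub_couplingFourier_algebraic hd1 hC₀ hα
  have hL0 : (0 : ℝ) < L := by exact_mod_cast hL
  -- the kernel on the Brillouin zone
  set g : (Fin d → ℝ) → ℝ := fun k => envelope d ((L : ℝ) • k) / (1 - couplingFourier J k) with hg
  have hgap0 : ∀ k, 0 ≤ 1 - couplingFourier J k := fun k => one_sub_couplingFourier_nonneg J hJ0 hJs hpos k
  have hg0' : ∀ p, 0 ≤ g p := fun p => div_nonneg (envelope_nonneg _) (hgap0 p)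
  have hg0 : ∀ p ∈ brillouin d, 0 ≤ g p := fun p _ => hg0' p
  have hgb : ∀ p ∈ brillouin d, p ≠ 0 → g p ≤ (1 / c₁) * (‖p‖ ^ 2)⁻¹ := by
    intro p hp hp0
    have h1 := hcube p (norm_le_pi_of_mem_brillouin hp)
    have hq0 : 0 < ‖p‖ := norm_pos_iff.2 hp0
    have h2 : 0 < c₁ * ‖p‖ ^ 2 := by positivity
    have h3 : 0 < 1 - couplingFourier J p := h2.trans_le h1
    calc g p ≤ 1 / (1 - couplingFourier J p) :=
          div_le_div_of_nonneg_right (envelope_le_one _) h3.le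
      _ ≤ 1 / (c₁ * ‖p‖ ^ 2) := div_le_div_of_nonneg_left zero_le_one h2 h1
      _ = (1 / c₁) * (‖p‖ ^ 2)⁻¹ := by rw [one_div, one_div, mul_inv]
  have hnum : Continuous fun k : Fin d → ℝ => envelope d ((L : ℝ) • k) :=
    continuous_envelope.comp (continuous_const_smul (L : ℝ))
  have hden : Continuous fun k : Fin d → ℝ => 1 - couplingFourier J k :=
    continuous_const.sub (continuous_couplingFourier J hJ0 hJs)
  have hgc : ∀ η : ℝ, 0 < η → ContinuousOn g (farRegion d η) := by
    intro η hη
    refine hnum.continuousOn.div hden.continuousOn fun p hp => ?_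
    obtain ⟨hpB, i, hi⟩ := hp
    have hp0 : p ≠ 0 := by
      rintro rfl
      simp only [Pi.zero_apply, abs_zero] at hi
      linarith
    have h1 := hcube p (norm_le_pi_of_mem_brillouin hpB)
    have hq0 : 0 < ‖p‖ := norm_pos_iff.2 hp0
    have h2 : 0 < c₁ * ‖p‖ ^ 2 := by positivity
    exact (h2.trans_le h1).ne'
  -- a.e. equality of the zones and integrability
  have hae : (momentumBox d 1 : Set (Fin d → ℝ)) =ᵐ[volume] brillouin d := momentumBox_one_ae_eq_brillouin
  have hIg : IntegrableOn (fun k => 1 / (1 - couplingFourier J k)) (brillouin d) :=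
    (integrableOn_inv_gap hd hC₀ hα).congr_set_ae hae.symm
  have hgi : IntegrableOn g (brillouin d) := by
    refine Integrable.mono' hIg (hnum.measurable.div hden.measurable).aestronglyMeasurable
      (ae_of_all _ fun k => ?_)
    rw [Real.norm_eq_abs, abs_of_nonneg (hg0' k)]
    simp only [hg]
    rw [div_eq_mul_one_div]
    exact mul_le_of_le_one_left (div_nonneg zero_le_one (hgap0 k)) (envelope_le_one _)
  -- the estimate through the tori
  have hm : magnetization J β = 0 := magnetization_eq_zero_of_lt_criticalBeta J β hβ hβc hJnn
  set K : ℝ := (9 * Real.pi ^ 2) ^ d * (L : ℝ) ^ (2 * d) / (β * couplingNorm J) with hK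
  have hK0 : 0 < K := by positivity
  set V : ℝ := (((2 * L + 1 : ℕ) : ℝ) ^ d) ^ 2 with hV
  have hV0 : 0 < V := by positivity
  have hπd : (0 : ℝ) < (2 * Real.pi) ^ d := by positivity
  have hmain : ∑ x ∈ box d L, ∑ y ∈ box d L, pairCorrelation J β 0 (x - y) ≤
      K * (((2 * Real.pi) ^ d)⁻¹ * ∫ p in brillouin d, g p) := by
    refine le_of_forall_pos_le_add fun ε hε => ?_
    obtain ⟨N₀, hN₀⟩ := torus_zeroMode_le_eventually J β hd1 hβ hJnn hJt hJs hm
      (show 0 < ε / 2 / V by positivity)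
    obtain ⟨N₁, hN₁⟩ := riemannSum_le_setIntegral_add d hd (by positivity : (0 : ℝ) ≤ 1 / c₁) hg0 hgb hgc hgi
      (show 0 < ε / 2 * (2 * Real.pi) ^ d / K by positivity)
    refine sum_sum_pairCorrelation_le_of_torus J β hβ.le hJnn hJt hJs (N₀ := max (max N₀ N₁) 4)
      fun M _ hM hMe => ?_
    have hM4 : 4 ≤ M := le_of_max_le_right hM
    have hMN₀ : N₀ ≤ M := (le_max_left _ _).trans (le_of_max_le_left hM)
    have hMN₁ : N₁ ≤ M := (le_max_right _ _).trans (le_of_max_le_left hM)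
    have hMpos : (0 : ℝ) < M := by exact_mod_cast (show 0 < M by omega)
    have hMd : (0 : ℝ) < (M : ℝ) ^ d := by positivity
    have hzero := hN₀ M hMN₀
    have hR := hN₁ M hMe hMN₁
    have htorus : ∑ x ∈ box d L, ∑ y ∈ box d L, torusExpect (torusCoupling J M) β 0
        (fun σ => spinAt 0 σ * spinAt (Torus.proj M x - Torus.proj M y) σ) ≤
        ((M : ℝ) ^ d)⁻¹ * (∑ z, torusExpect (torusCoupling J M) β 0 (fun σ => spinAt 0 σ * spinAt z σ)) * V +
          K * (((2 * Real.pi) ^ d)⁻¹ * (gridStep M ^ d *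
            ∑ j ∈ (univ : Finset (TorusSite d M)).erase (centerIndex d M), g (cellCorner j))) :=
      torus_sum_sum_box_le_kernel hd hC₀ hα hc₁ hcube hMe hM4 hL hβ
    refine htorus.trans ?_
    have h1 : ((M : ℝ) ^ d)⁻¹ * (∑ z, torusExpect (torusCoupling J M) β 0 (fun σ => spinAt 0 σ * spinAt z σ)) * V ≤
        ε / 2 := by
      calc ((M : ℝ) ^ d)⁻¹ * (∑ z, torusExpect (torusCoupling J M) β 0 (fun σ => spinAt 0 σ * spinAt z σ)) * V
          ≤ ((M : ℝ) ^ d)⁻¹ * (ε / 2 / V * (M : ℝ) ^ d) * V :=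
            mul_le_mul_of_nonneg_right (mul_le_mul_of_nonneg_left hzero (by positivity)) hV0.le
        _ = ε / 2 := by field_simp
    have h2 : K * (((2 * Real.pi) ^ d)⁻¹ * (gridStep M ^ d *
        ∑ j ∈ (univ : Finset (TorusSite d M)).erase (centerIndex d M), g (cellCorner j))) ≤
        K * (((2 * Real.pi) ^ d)⁻¹ * ∫ p in brillouin d, g p) + ε / 2 := by
      calc K * (((2 * Real.pi) ^ d)⁻¹ * (gridStep M ^ d *
            ∑ j ∈ (univ : Finset (TorusSite d M)).erase (centerIndex d M), g (cellCorner j)))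
          ≤ K * (((2 * Real.pi) ^ d)⁻¹ * ((∫ p in brillouin d, g p) + ε / 2 * (2 * Real.pi) ^ d / K)) := by
            gcongr
        _ = K * (((2 * Real.pi) ^ d)⁻¹ * ∫ p in brillouin d, g p) + ε / 2 := by
            field_simp
    linarith [h1, h2]
  -- the substitution `u = Lk`
  set G' : (Fin d → ℝ) → ℝ := fun u => envelope d u / (1 - couplingFourier J (fun i => u i / L)) with hG'
  have hgL : ∀ k, g k = G' ((L : ℝ) • k) := by
    intro k
    simp only [hG', hg, Pi.smul_apply, smul_eq_mul]
    congr 3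
    funext i
    field_simp
  have hsubst : ∫ k in momentumBox d 1, G' ((L : ℝ) • k) = ((L : ℝ) ^ d)⁻¹ * ∫ u in momentumBox d L, G' u := by
    have := Measure.setIntegral_comp_smul_of_pos (μ := (volume : Measure (Fin d → ℝ))) G' (momentumBox d 1) hL0
    rw [smul_momentumBox_one hL0, Module.finrank_fin_fun, smul_eq_mul] at this
    exact this
  have hIeq : ∫ p in brillouin d, g p = ((L : ℝ) ^ d)⁻¹ * ∫ u in momentumBox d L, G' u := by
    rw [← setIntegral_congr_set hae, ← hsubst]
    exact setIntegral_congr_fun (measurableSet_momentumBox 1) fun k _ => hgL k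
  refine hmain.trans (le_of_eq ?_)
  rw [hIeq, hK]
  have e : (L : ℝ) ^ (2 * d) = (L : ℝ) ^ d * (L : ℝ) ^ d := by rw [two_mul, pow_add]
  rw [e]
  field_simp

end InfiniteVolumeKernel

end LongRangeIsing

open LongRangeIsing

/-! ### DISCHARGE of `panis_prop38_kernelForm` -/

/-- **DISCHARGE of the named fact `panis_prop38_kernelForm` (Panis 2023, Proposition 3.8, first display,
kernel form): for `J_{x,y} = C₀|x-y|₁^{-d-α}`, `d ≥ 3`, `C₀, α > 0` (every `α`), there is `C` with
`S_β(x) ≤ C/(β|x|^d) ∫_{(-π|x|,π|x|]^d} W(p)/(1 - Ĵ(p/|x|)) dp` for all `0 < β ≤ β_c`, `x ≠ 0`.**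
Proof = the printed proof of Proposition 3.8 with the torus infrared bound (Proposition 3.4, proved:
`torus_twoPointFourier_le`) in place of Proposition 3.7: for `x ≠ 0`, `n = |x|_∞`, MMS2 (the tree's theorem
`panis_mms_two_point_monotone_holds`) averaged over `Λ_{⌊n/d⌋}` and `χ_{⌊n/d⌋} ≤ χ_{⌊n/2⌋}` give
`n^d (n/d)^d S_β(x) ≤ ∑_{x,y∈Λ_n} S_β(x-y)`; the double sum is bounded by
`sum_sum_pairCorrelation_le_kernel` (Parseval on the even tori, Gaussian domination off the zero mode, the
vanishing of the zero mode below `β_c`, the Riemann sum of the exact kernel, Griffiths' comparison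
free ≤ torus, `u = np`) for `β < β_c`; `β = β_c` by left-continuity (`tendsto_pairCorrelation_nhdsLT`).
No uniqueness of the infinite-volume state and no finiteness of the susceptibility below `β_c` is used,
and no restriction `α ≠ 2` is needed (the kernel `1/(1-Ĵ)` is kept exact).
[cite: Panis2023Triviality, Proposition 3.8 (first display) and its proof, with Proposition 3.4, Remark 3.5 and Corollary 3.3 (MMS2)] -/
theorem panis_prop38_kernelForm_holds : panis_prop38_kernelForm := by
  intro d hd C₀ α hC₀ hα
  have hd1 : 1 ≤ d := by omega
  set J := algebraicCoupling d C₀ α with hJdef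
  have hpos := couplingNorm_algebraic_pos hd1 hC₀ hα
  have hJnn : ∀ x y, 0 ≤ J x y := algebraicCoupling_nonneg hC₀.le α
  set K : ℝ := (9 * Real.pi ^ 2) ^ d / (2 * Real.pi) ^ d with hKdef
  have hK : 0 < K := by positivity
  set C : ℝ := K * (d : ℝ) ^ d / couplingNorm J with hCdef
  have hC : 0 < C := by positivity
  refine ⟨C, hC, fun β hβ hββc x hx => ?_⟩
  set n : ℕ := Site.supNorm x with hndef
  have hxn : ‖x‖ = n := Site.norm_eq_supNorm x
  have hn1 : 1 ≤ n := Nat.one_le_iff_ne_zero.2 fun h => hx (Site.supNorm_eq_zero_iff.1 h)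
  have hn0 : (0 : ℝ) < n := by exact_mod_cast hn1
  set I : ℝ := ∫ u in momentumBox d n, envelope d u / (1 - couplingFourier J (fun i => u i / n)) with hIdef
  rw [hxn]
  -- the bound below `β_c`
  have hsub : ∀ β', 0 < β' → β' < LongRangeIsing.criticalBeta J →
      pairCorrelation J β' 0 x ≤ C / (β' * (n : ℝ) ^ d) * I := by
    intro β' hβ' hβ'c
    have hmms : ∀ a b : Site d, (d : ℝ) * ‖a‖ ≤ ‖b‖ → pairCorrelation J β' 0 b ≤ pairCorrelation J β' 0 a :=
      panis_mms_two_point_monotone_holds d hd1 C₀ α hC₀ hα β' hβ'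
    -- MMS averaging over `Λ_{⌊n/d⌋}`
    have h1 : (#(box d (n / d)) : ℝ) * pairCorrelation J β' 0 x ≤ boxSusceptibility J β' (n / d) :=
      card_box_mul_pairCorrelation_le_boxSusceptibility J β' hmms (by rw [hndef]; exact Nat.mul_div_le _ d)
    -- monotonicity `χ_{⌊n/d⌋} ≤ χ_{⌊n/2⌋}`
    have h2 : boxSusceptibility J β' (n / d) ≤ boxSusceptibility J β' (n / 2) :=
      boxSusceptibility_mono J β' hβ'.le hJnn (Nat.div_le_div_left (by omega) two_pos)
    -- the double sum
    have h3 : (#(box d (n / 2)) : ℝ) * boxSusceptibility J β' (n / 2) ≤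
        ∑ a ∈ box d n, ∑ b ∈ box d n, pairCorrelation J β' 0 (a - b) :=
      card_box_mul_boxSusceptibility_le_sum_sum J β' hβ'.le hJnn (Nat.mul_div_le n 2 |> fun h => by omega)
    have h4 := sum_sum_pairCorrelation_le_kernel (d := d) hd hC₀ hα hβ' hβ'c hn1
    -- cardinalities
    have hc1 : ((n : ℝ)) ^ d ≤ #(box d (n / 2)) := pow_le_card_box_half' d n
    have hc2 : ((n : ℝ) / d) ^ d ≤ #(box d (n / d)) := div_pow_le_card_box_div hd1 n
    have hcpos1 : (0 : ℝ) < #(box d (n / 2)) := lt_of_lt_of_le (by positivity) hc1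
    have hcpos2 : (0 : ℝ) < #(box d (n / d)) := lt_of_lt_of_le (by positivity) hc2
    -- combine: `|Λ_{n/d}| |Λ_{n/2}| S(x) ≤ K n^d/(β|J|) I`
    have h6 : (#(box d (n / 2)) : ℝ) * ((#(box d (n / d)) : ℝ) * pairCorrelation J β' 0 x) ≤
        K * ((n : ℝ) ^ d / (β' * couplingNorm J)) * I :=
      (mul_le_mul_of_nonneg_left (h1.trans h2) hcpos1.le).trans (h3.trans h4)
    have h7 : (n : ℝ) ^ d * (((n : ℝ) / d) ^ d * pairCorrelation J β' 0 x) ≤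
        K * ((n : ℝ) ^ d / (β' * couplingNorm J)) * I := by
      refine le_trans ?_ h6
      have hS := pairCorrelation_nonneg J β' hβ'.le hJnn 0 x
      exact mul_le_mul hc1 (mul_le_mul_of_nonneg_right hc2 hS) (by positivity) hcpos1.le
    -- solve for `S(x)`
    have hd0 : (0 : ℝ) < d := by exact_mod_cast hd1
    have hnd : (0 : ℝ) < (n : ℝ) ^ d * ((n : ℝ) / d) ^ d := by positivity
    rw [← mul_assoc] at h7
    have h8 : pairCorrelation J β' 0 x ≤
        K * ((n : ℝ) ^ d / (β' * couplingNorm J)) * I / ((n : ℝ) ^ d * ((n : ℝ) / d) ^ d) :=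
      (le_div_iff₀' hnd).2 h7
    refine h8.trans (le_of_eq ?_)
    rw [hCdef, div_pow]
    field_simp
  -- `β < β_c` or `β = β_c` (left-continuity)
  rcases hββc.lt_or_eq with hlt | heq
  · exact hsub β hβ hlt
  · have hβc : 0 < LongRangeIsing.criticalBeta J := hβ.trans_le hββc
    rw [heq]
    have hlim := tendsto_pairCorrelation_nhdsLT J hJnn hβc (0 : Site d) x
    have hR : Tendsto (fun β' : ℝ => C / (β' * (n : ℝ) ^ d) * I) (𝓝[<] LongRangeIsing.criticalBeta J)
        (𝓝 (C / (LongRangeIsing.criticalBeta J * (n : ℝ) ^ d) * I)) := by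
      refine (ContinuousAt.tendsto ?_).mono_left nhdsWithin_le_nhds
      refine ((continuousAt_const.div (continuousAt_id.mul continuousAt_const) ?_).mul continuousAt_const)
      exact mul_ne_zero hβc.ne' (pow_ne_zero _ hn0.ne')
    refine le_of_tendsto_of_tendsto hlim hR ?_
    filter_upwards [Ioo_mem_nhdsLT hβc] with β' hβ'
    exact hsub β' hβ'.1 hβ'.2

end Literature.Barriers.CriticalPhenomena
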